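import Mathlib.NumberTheory.NumberField.Basic
import Mathlib.NumberTheory.NumberField.Ideal.KummerDedekind
import Mathlib.RingTheory.Discriminant
import Mathlib.RingTheory.Polynomial.Eisenstein.Basic
import Mathlib.RingTheory.Polynomial.Eisenstein.IsIntegral
import Mathlib.FieldTheory.Minpoly.IsIntegrallyClosed
import Mathlib.RingTheory.Ideal.Norm.AbsNorm
import Mathlib.Data.ZMod.QuotientRing
import Literature.NumberTheory.LFunctions.DegreeOnePrimes
import HarnessLib

/-!
# The pure cubic field `K = ℚ(2^{1/3})`: `𝓞_K = ℤ[2^{1/3}]`, and Heath-Brown's Lemma 3.1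

Topic `Literature/NumberTheory/LFunctions` (algebraic number theory of one concrete field; it is
the field of Heath-Brown's theorem on primes `x³ + 2y³`, `Sieve/HeathBrownCubicPrimes*.lean`,
parity.S18). Everything in this file is PROVED (no `sorry`, no named facts).

## Content (namespace `Literature.CubeRootTwoField`)

* `cubicPoly = X³ − 2 ∈ ℤ[X]` (Eisenstein at `2`, irreducible), `K = AdjoinRoot (X³ − 2) = ℚ(θ)`,
  `θ = 2^{1/3}` (`θ_pow_three`), `minpoly ℤ θ = X³ − 2`, the power basis `pbθ = (1, θ, θ²)`,
  `finrank ℚ K = 3`, `norm θ = 2`, and the discriminant `discr ℚ pbθ.basis = −108 = −2²·3³`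
  (`discr_pbθ`).
* **`isIntegralClosure_adjoin_θ` — `𝓞_K = ℤ[2^{1/3}]`** (`{1, θ, θ²}` is an integral basis,
  `d(K) = −108`; Alaca–Williams, Thm. 7.3.2 with `m = 2`, and the row `k = 2` of Table 1).
  Proof (Dedekind's, in the form Mathlib uses for `ℤ[ζ_{p^k}]`,
  `IsCyclotomicExtension.Rat.isIntegralClosure_adjoin_singleton_of_prime_pow`): for `z ∈ 𝓞_K`,
  `disc · z = −108 z ∈ ℤ[θ]` (`Algebra.discr_mul_isIntegral_mem_adjoin`); `X³ − 2` is Eisenstein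
  at `2`, so `4 · (27 z) ∈ ℤ[θ] ⇒ 27 z ∈ ℤ[θ]`
  (`mem_adjoin_of_smul_prime_pow_smul_of_minpoly_isEisensteinAt`); the minimal polynomial of
  `θ + 1` is `X³ − 3X² + 3X − 3`, Eisenstein at `3`, and `ℤ[θ + 1] = ℤ[θ]`, so `z ∈ ℤ[θ]`.
  Consequences: `adjoin_θint_eq_top` (`ℤ[θ] = 𝓞_K` inside `𝓞_K`), `exponent_θint`
  (the Dedekind–Kummer conductor exponent of `θ` is `1`), and
  **`card_absNorm_eq_prime`**: for EVERY prime `p`, the number of ideals of `𝓞_K` of norm `p`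
  (the first-degree prime ideals above `p`) is `#{n mod p : n³ ≡ 2}` — Dedekind's theorem as used
  by Heath-Brown (p. 21: "the first degree prime ideals above `p` take the form `(p, n − 2^{1/3})`,
  where `n` runs over the distinct solutions of `n³ ≡ 2 (mod p)`"; p. 6: `ν_p` "agrees with that
  defined in the statement of our theorem"), with no exceptional primes.
* **Heath-Brown's Lemma 3.1** [HeathBrownActa2001, Lemma 3.1, p. 11; proof p. 21], for
  `x, y ∈ ℤ` coprime and the algebraic integer `x + y θ`:
  `prime_absNorm_of_mem` — every prime ideal `P ∋ x + yθ` has prime norm ("no prime ideal of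
  degree greater than 1 can divide an element of `𝒜^(K)`");
  `eq_of_mem_of_absNorm_eq` — two prime ideals containing `x + yθ` with equal norms are equal
  ("nor can a product of two distinct first degree prime ideals of the same norm");
  `squarefree_absNorm_of_mem` — "if a square-free ideal `R` divides an element of `𝒜^(K)`, then
  `N(R)` must be square-free".
  The proof is the printed one (p. 21): if `P ∣ y` then `P ∣ x`, contradicting `(x, y) = 1`;
  otherwise `2^{1/3} ≡ −x y^{−1} (mod P)`, so every element of `ℤ[2^{1/3}] = 𝓞_K` is congruent to
  a rational integer and `𝓞_K/P ≅ ℤ/p` (`absNorm_eq_and_isMaximal`: an ideal `I ∌ 1` containing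
  `p` and some `θ − m` has `𝓞_K/I ≅ ℤ/p`, so it is maximal of norm `p`); two such primes of the
  same norm `p` both contain the maximal ideal `(p, θ − m)` with the same `m`, hence coincide.

## Faithfulness / modelling notes

* `K` is modelled as `AdjoinRoot ((X³ − 2 : ℤ[X]).map (algebraMap ℤ ℚ))`, the model already used
  for `ℚ[X]/(g)` in `DegreeOnePrimes.exists_card_absNorm_eq_prime_eq_rootCount`; "divides an
  element `x + y·2^{1/3}` of `𝒜^(K)`" is rendered as membership `x + y θ ∈ P` (for ideals of a
  Dedekind domain `P ∣ (a) ↔ a ∈ P`), and "`(x, y) = 1`" as `IsCoprime x y` in `ℤ`.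
* Lemma 3.1 is stated in the paper for prime ideals; the engine `absNorm_eq_of_prime_mem` is the
  slightly more general printed argument (any proper ideal containing `x + yθ` and a rational
  prime `q` is the maximal ideal `(q, θ − m)` of norm `q`).

## References

* D. R. Heath-Brown, *Primes represented by `x³ + 2y³`*, Acta Math. 186 (2001), 1–84, Lemma 3.1
  (p. 11) and its proof (§4, p. 21). [cite: HeathBrownActa2001, Lemma 3.1]
* S. Alaca, K. S. Williams, *Introductory Algebraic Number Theory*, Cambridge Univ. Press (2003),
  Thm. 7.3.2 and Table 1 (integral basis `{1, θ, θ²}` and `d(K) = −108` for `ℚ(2^{1/3})`).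
  [cite: AlacaWilliams2003, Thm. 7.3.2]
* R. Dedekind, *Über den Zusammenhang zwischen der Theorie der Ideale und der Theorie der
  höheren Congruenzen*, Abh. Kgl. Ges. Wiss. Göttingen 23 (1878), 1–23. [folklore]

## Mathlib / tree search

Mathlib has no pure cubic field and no ring of integers beyond quadratic and cyclotomic fields
(searched `X ^ 3 - C 2`, `cubeRoot`, `isIntegralClosure_adjoin_singleton`); used:
`Polynomial.IsEisensteinAt.irreducible`, `Algebra.discr_powerBasis_eq_norm`,
`PowerBasis.norm_gen_eq_coeff_zero_minpoly`, `Algebra.discr_mul_isIntegral_mem_adjoin`,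
`mem_adjoin_of_smul_prime_pow_smul_of_minpoly_isEisensteinAt`, `PowerBasis.ofAdjoinEqTop'`,
`RingOfIntegers.exponent_eq_one_iff`, `RingHom.quotientKerEquivOfSurjective`,
`Int.quotientSpanNatEquivZMod`, `Ideal.prod_normalizedFactors_eq_self`,
`UniqueFactorizationMonoid.squarefree_iff_nodup_normalizedFactors`,
`Nat.squarefree_iff_nodup_primeFactorsList`, `Nat.primeFactorsList_unique`.
Tree: `Literature.NumberTheory.LFunctions.DegreeOnePrimes.card_absNorm_eq_prime_eq_card_roots`, `.card_roots_toFinset_eq_card_range_filter`,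
`.mem_adjoin_of_coe_mem_adjoin` (`LFunctions/DegreeOnePrimes.lean`).
-/

noncomputable section

open Polynomial NumberField Algebra Finset

namespace Literature.NumberTheory.LFunctions.CubeRootTwoField

/-! ### `X³ − 2`, the field `K = ℚ(2^{1/3})` and its power basis -/

/-- `X³ − 2 ∈ ℤ[X]`. [folklore] -/
abbrev cubicPoly : ℤ[X] := X ^ 3 - C 2

/-- `X³ − 2 ∈ ℚ[X]` (base change of `cubicPoly`). [folklore] -/
abbrev cubicPolyRat : ℚ[X] := cubicPoly.map (algebraMap ℤ ℚ)

/-- `cubicPolyRat = X³ − 2`. [folklore] -/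
theorem cubicPolyRat_eq : cubicPolyRat = X ^ 3 - C 2 := by
  rw [cubicPolyRat, cubicPoly, Polynomial.map_sub, Polynomial.map_pow, map_X, Polynomial.map_C,
    map_ofNat]

/-- `X³ − 2` is monic. [folklore] -/
theorem cubicPoly_monic : cubicPoly.Monic := monic_X_pow_sub_C 2 three_ne_zero

/-- `deg (X³ − 2) = 3`. [folklore] -/
theorem cubicPoly_natDegree : cubicPoly.natDegree = 3 := natDegree_X_pow_sub_C

/-- `X³ − 2` is Eisenstein at `2`. [folklore] -/
theorem cubicPoly_isEisensteinAt : cubicPoly.IsEisensteinAt (Ideal.span {(2 : ℤ)}) := by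
  refine ⟨?_, fun {n} hn => ?_, ?_⟩
  · rw [cubicPoly_monic.leadingCoeff, Ideal.mem_span_singleton]; norm_num
  · rw [cubicPoly_natDegree] at hn
    interval_cases n <;> simp [cubicPoly, coeff_X_pow]
  · rw [Ideal.span_singleton_pow, Ideal.mem_span_singleton]
    simp [cubicPoly, coeff_X_pow]

/-- `X³ − 2` is irreducible over `ℤ` (Eisenstein). [folklore] -/
theorem cubicPoly_irreducible : Irreducible cubicPoly :=
  cubicPoly_isEisensteinAt.irreducible (Ideal.span_singleton_prime (by norm_num) |>.2 Int.prime_two)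
    cubicPoly_monic.isPrimitive (by rw [cubicPoly_natDegree]; norm_num)

/-- `X³ − 2` is irreducible over `ℚ` (Gauss). [folklore] -/
theorem cubicPolyRat_irreducible : Irreducible cubicPolyRat :=
  cubicPoly_monic.irreducible_iff_irreducible_map_fraction_map.mp cubicPoly_irreducible

/-- The irreducibility of `X³ − 2` over `ℚ` as a `Fact` instance, so that
`AdjoinRoot cubicPolyRat` is a field. [folklore] -/
instance : Fact (Irreducible cubicPolyRat) := ⟨cubicPolyRat_irreducible⟩

/-- `cubicPolyRat ≠ 0`. [folklore] -/
theorem cubicPolyRat_ne_zero : cubicPolyRat ≠ 0 := cubicPolyRat_irreducible.ne_zero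

/-- `K = ℚ(2^{1/3}) = ℚ[X]/(X³ − 2)`, the field of Heath-Brown's theorem (p. 5).
[cite: HeathBrownActa2001, §2 p. 5] -/
abbrev K : Type := AdjoinRoot cubicPolyRat

/-- `K = ℚ[X]/(X³ − 2)` is a number field. [folklore] -/
instance : NumberField K := by unfold K; infer_instance

/-- `θ = 2^{1/3} ∈ K`, the class of `X`. [folklore] -/
def θ : K := AdjoinRoot.root cubicPolyRat

/-- `θ³ = 2`. [folklore] -/
theorem θ_pow_three : θ ^ 3 = 2 := by
  have h : eval₂ (AdjoinRoot.of cubicPolyRat) (AdjoinRoot.root cubicPolyRat) cubicPolyRat = 0 :=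
    AdjoinRoot.eval₂_root cubicPolyRat
  rw [eval₂_map, cubicPoly, eval₂_sub, eval₂_X_pow, eval₂_C, map_ofNat, sub_eq_zero] at h
  exact h

/-- `θ` is a root of `X³ − 2`. [folklore] -/
theorem aeval_θ_cubicPoly : aeval θ cubicPoly = 0 := by
  rw [cubicPoly, map_sub, map_pow, aeval_X, aeval_C, map_ofNat, θ_pow_three, sub_self]

/-- `θ` is an algebraic integer. [folklore] -/
theorem isIntegral_θ : IsIntegral ℤ θ := ⟨cubicPoly, cubicPoly_monic, aeval_θ_cubicPoly⟩

/-- `minpoly_ℤ θ = X³ − 2`. [folklore] -/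
theorem minpoly_int_θ : minpoly ℤ θ = cubicPoly :=
  (eq_of_monic_of_associated (minpoly.monic isIntegral_θ) cubicPoly_monic
    ((minpoly.irreducible isIntegral_θ).associated_of_dvd cubicPoly_irreducible
      (minpoly.isIntegrallyClosed_dvd isIntegral_θ aeval_θ_cubicPoly)))

/-- `minpoly_ℚ θ = X³ − 2`. [folklore] -/
theorem minpoly_rat_θ : minpoly ℚ θ = X ^ 3 - C 2 := by
  rw [minpoly.isIntegrallyClosed_eq_field_fractions' ℚ isIntegral_θ, minpoly_int_θ]
  exact cubicPolyRat_eq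

/-- The power basis `1, θ, θ²` of `K` over `ℚ`. [folklore] -/
def pbθ : PowerBasis ℚ K := AdjoinRoot.powerBasis cubicPolyRat_ne_zero

/-- The generator of `pbθ` is `θ`. [folklore] -/
theorem pbθ_gen : pbθ.gen = θ := AdjoinRoot.powerBasis_gen _

/-- `pbθ` has dimension `3`. [folklore] -/
theorem pbθ_dim : pbθ.dim = 3 := by
  rw [pbθ, AdjoinRoot.powerBasis_dim, cubicPolyRat_eq, natDegree_X_pow_sub_C]

/-- `[K : ℚ] = 3`. [folklore] -/
theorem finrank_K : Module.finrank ℚ K = 3 := by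
  rw [← pbθ_dim, PowerBasis.finrank]

/-- `N_{K/ℚ}(θ) = 2`. [folklore] -/
theorem norm_θ : Algebra.norm ℚ θ = 2 := by
  have h := PowerBasis.norm_gen_eq_coeff_zero_minpoly pbθ
  rw [pbθ_gen, pbθ_dim, minpoly_rat_θ] at h
  rw [h]; simp [coeff_X_pow, coeff_C]; norm_num

/-- `f'(θ) = 3θ²` for `f = minpoly_ℚ θ = X³ − 2`. [folklore] -/
theorem aeval_derivative_minpoly :
    aeval θ (derivative (minpoly ℚ θ)) = algebraMap ℚ K 3 * θ ^ 2 := by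
  rw [minpoly_rat_θ, derivative_sub, derivative_X_pow, derivative_C, sub_zero, map_mul, aeval_C,
    map_pow, aeval_X]
  norm_num

/-- **`disc(1, θ, θ²) = −108 = −2²·3³`** (Alaca–Williams, Table 1, row `k = 2`).
[cite: AlacaWilliams2003, Thm. 7.3.2] -/
theorem discr_pbθ : Algebra.discr ℚ pbθ.basis = -108 := by
  rw [Algebra.discr_powerBasis_eq_norm, finrank_K, pbθ_gen, aeval_derivative_minpoly, map_mul,
    map_pow, Algebra.norm_algebraMap, finrank_K, norm_θ]
  norm_num

/-! ### The shifted generator `θ + 1` (Eisenstein at `3`) -/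

/-- `X³ − 3X² + 3X − 3 = (X − 1)³ − 2 ∈ ℤ[X]`, the minimal polynomial of `θ + 1`. [folklore] -/
def cubicPolyShift : ℤ[X] := X ^ 3 - C 3 * X ^ 2 + C 3 * X - C 3

/-- `deg = 3`. [folklore] -/
theorem cubicPolyShift_natDegree : cubicPolyShift.natDegree = 3 := by
  rw [cubicPolyShift]; compute_degree!

/-- Monic. [folklore] -/
theorem cubicPolyShift_monic : cubicPolyShift.Monic := by
  rw [cubicPolyShift]; monicity!

/-- `X³ − 3X² + 3X − 3` is Eisenstein at `3`. [folklore] -/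
theorem cubicPolyShift_isEisensteinAt : cubicPolyShift.IsEisensteinAt (Ideal.span {(3 : ℤ)}) := by
  refine ⟨?_, fun {n} hn => ?_, ?_⟩
  · rw [cubicPolyShift_monic.leadingCoeff, Ideal.mem_span_singleton]; norm_num
  · rw [cubicPolyShift_natDegree] at hn
    interval_cases n <;> simp [cubicPolyShift, coeff_X_pow, coeff_X]
  · rw [Ideal.span_singleton_pow, Ideal.mem_span_singleton]
    simp [cubicPolyShift, coeff_X_pow, coeff_X]

/-- Irreducible (Eisenstein at `3`). [folklore] -/
theorem cubicPolyShift_irreducible : Irreducible cubicPolyShift :=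
  cubicPolyShift_isEisensteinAt.irreducible
    (Ideal.span_singleton_prime (by norm_num) |>.2 Int.prime_three)
    cubicPolyShift_monic.isPrimitive (by rw [cubicPolyShift_natDegree]; norm_num)

/-- `θ + 1` is a root of `X³ − 3X² + 3X − 3`. [folklore] -/
theorem aeval_θ_add_one_cubicPolyShift : aeval (θ + 1) cubicPolyShift = 0 := by
  have h3 := θ_pow_three
  simp only [cubicPolyShift, map_sub, map_add, map_mul, map_pow, aeval_X, map_ofNat]
  linear_combination h3

/-- `θ + 1` is an algebraic integer. [folklore] -/
theorem isIntegral_θ_add_one : IsIntegral ℤ (θ + 1) := isIntegral_θ.add isIntegral_one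

/-- `minpoly_ℤ (θ + 1) = X³ − 3X² + 3X − 3`. [folklore] -/
theorem minpoly_int_θ_add_one : minpoly ℤ (θ + 1) = cubicPolyShift :=
  (eq_of_monic_of_associated (minpoly.monic isIntegral_θ_add_one) cubicPolyShift_monic
    ((minpoly.irreducible isIntegral_θ_add_one).associated_of_dvd cubicPolyShift_irreducible
      (minpoly.isIntegrallyClosed_dvd isIntegral_θ_add_one aeval_θ_add_one_cubicPolyShift)))

/-- `θ ∈ R[θ + 1]`. [folklore] -/
theorem θ_mem_adjoin_θ_add_one (R : Type*) [CommRing R] [Algebra R K] :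
    θ ∈ Algebra.adjoin R ({θ + 1} : Set K) := by
  have h : θ + 1 - 1 ∈ Algebra.adjoin R ({θ + 1} : Set K) :=
    Subalgebra.sub_mem _ (Algebra.self_mem_adjoin_singleton R (θ + 1 : K)) (Subalgebra.one_mem _)
  rwa [add_sub_cancel_right] at h

/-- `ℤ[θ + 1] = ℤ[θ]`. [folklore] -/
theorem adjoin_θ_add_one_eq : Algebra.adjoin ℤ ({θ + 1} : Set K) = Algebra.adjoin ℤ {θ} := by
  apply le_antisymm
  · refine Algebra.adjoin_le ?_
    rw [Set.singleton_subset_iff, SetLike.mem_coe]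
    exact Subalgebra.add_mem _ (Algebra.self_mem_adjoin_singleton ℤ θ) (Subalgebra.one_mem _)
  · refine Algebra.adjoin_le ?_
    rw [Set.singleton_subset_iff, SetLike.mem_coe]
    exact θ_mem_adjoin_θ_add_one ℤ

/-- `ℚ(θ + 1) = K`. [folklore] -/
theorem adjoin_rat_θ_add_one_eq_top : Algebra.adjoin ℚ ({θ + 1} : Set K) = ⊤ := by
  refine PowerBasis.adjoin_eq_top_of_gen_mem_adjoin (B := pbθ) ?_
  rw [pbθ_gen]
  exact θ_mem_adjoin_θ_add_one ℚ

/-- The power basis of `K` over `ℚ` generated by `θ + 1`. [folklore] -/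
def pbθ' : PowerBasis ℚ K :=
  PowerBasis.ofAdjoinEqTop' (isIntegral_θ_add_one.tower_top) adjoin_rat_θ_add_one_eq_top

/-- The generator of `pbθ'` is `θ + 1`. [folklore] -/
theorem pbθ'_gen : pbθ'.gen = θ + 1 := PowerBasis.ofAdjoinEqTop'_gen _ _

/-! ### `𝓞_K = ℤ[2^{1/3}]` -/

/-- **`𝓞_K = ℤ[2^{1/3}]`**: `ℤ[θ]` is the integral closure of `ℤ` in `K = ℚ(θ)`, `θ³ = 2`; i.e.
`{1, θ, θ²}` is an integral basis (Alaca–Williams, Thm. 7.3.2 with `m = h = 2`, `k = 1`,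
`m² = 4 ≢ 1 (mod 9)`; Table 1, `k = 2`). Proof by the discriminant `−108 = −2²·3³` and the
Eisenstein criterion at `2` (for `θ`) and at `3` (for `θ + 1`).
[cite: AlacaWilliams2003, Thm. 7.3.2] -/
theorem isIntegralClosure_adjoin_θ :
    IsIntegralClosure (Algebra.adjoin ℤ ({θ} : Set K)) ℤ K := by
  refine ⟨Subtype.val_injective, fun {x} => ⟨fun h => ⟨⟨x, ?_⟩, rfl⟩, ?_⟩⟩
  swap
  · rintro ⟨y, rfl⟩
    exact IsIntegral.algebraMap
      ((le_integralClosure_iff_isIntegral.1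
        (adjoin_le_integralClosure isIntegral_θ)).isIntegral _)
  have hint : IsIntegral ℤ pbθ.gen := by rw [pbθ_gen]; exact isIntegral_θ
  have H := Algebra.discr_mul_isIntegral_mem_adjoin ℚ hint h
  rw [discr_pbθ, pbθ_gen] at H
  -- `108 x = 4 · (27 x) ∈ ℤ[θ]`
  have H4 : (2 : ℤ) ^ 2 • ((3 : ℤ) ^ 3 • x) ∈ Algebra.adjoin ℤ ({θ} : Set K) := by
    have e : (2 : ℤ) ^ 2 • ((3 : ℤ) ^ 3 • x) = -((-108 : ℚ) • x) := by
      rw [smul_smul, ← neg_smul, neg_neg, ← algebraMap_smul ℚ ((2 : ℤ) ^ 2 * (3 : ℤ) ^ 3) x]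
      norm_num
    rw [e]
    exact Subalgebra.neg_mem _ H
  -- Eisenstein at `2` (`minpoly θ = X³ − 2`): `27 x ∈ ℤ[θ]`
  have H27 : (3 : ℤ) ^ 3 • x ∈ Algebra.adjoin ℤ ({θ} : Set K) := by
    have h2 := mem_adjoin_of_smul_prime_pow_smul_of_minpoly_isEisensteinAt (B := pbθ)
      Int.prime_two hint (h.smul ((3 : ℤ) ^ 3)) (by rw [pbθ_gen]; exact H4)
      (by rw [pbθ_gen, minpoly_int_θ]; exact cubicPoly_isEisensteinAt)
    rwa [pbθ_gen] at h2
  -- Eisenstein at `3` (`minpoly (θ + 1) = X³ − 3X² + 3X − 3`): `x ∈ ℤ[θ + 1] = ℤ[θ]`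
  have hint' : IsIntegral ℤ pbθ'.gen := by rw [pbθ'_gen]; exact isIntegral_θ_add_one
  have h3 := mem_adjoin_of_smul_prime_pow_smul_of_minpoly_isEisensteinAt (B := pbθ')
    Int.prime_three hint' h (by rw [pbθ'_gen, adjoin_θ_add_one_eq]; exact H27)
    (by rw [pbθ'_gen, minpoly_int_θ_add_one]; exact cubicPolyShift_isEisensteinAt)
  rwa [pbθ'_gen, adjoin_θ_add_one_eq] at h3

/-- `θ = 2^{1/3}` as an element of `𝓞 K`. [folklore] -/
def θint : 𝓞 K := ⟨θ, isIntegral_θ⟩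

/-- The coercion of `θint` to `K` is `θ`. [folklore] -/
@[simp] theorem coe_θint : ((θint : 𝓞 K) : K) = θ := rfl

/-- `ℤ[θ] = 𝓞_K`, as subalgebras of `𝓞_K`. [cite: AlacaWilliams2003, Thm. 7.3.2] -/
theorem adjoin_θint_eq_top : Algebra.adjoin ℤ ({θint} : Set (𝓞 K)) = ⊤ := by
  refine Algebra.eq_top_iff.2 fun b => ?_
  apply Literature.NumberTheory.LFunctions.DegreeOnePrimes.mem_adjoin_of_coe_mem_adjoin
  have hb : IsIntegral ℤ (b : K) := RingOfIntegers.isIntegral_coe b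
  haveI := isIntegralClosure_adjoin_θ
  obtain ⟨y, hy⟩ := (IsIntegralClosure.isIntegral_iff (A := Algebra.adjoin ℤ ({θ} : Set K))).mp hb
  rw [coe_θint, ← hy]
  exact y.2

/-- The conductor of `ℤ[θ] ⊆ 𝓞_K` is trivial: the Dedekind–Kummer exponent of `θ` is `1`, so
Dedekind's factorisation theorem applies at every prime. [folklore] -/
theorem exponent_θint : RingOfIntegers.exponent θint = 1 :=
  RingOfIntegers.exponent_eq_one_iff.mpr adjoin_θint_eq_top

/-- `minpoly_ℤ θint = X³ − 2`. [folklore] -/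
theorem minpoly_θint : minpoly ℤ θint = cubicPoly := by
  rw [← RingOfIntegers.minpoly_coe, coe_θint]
  convert minpoly_int_θ
  exact Subsingleton.elim _ _

/-- **Dedekind's theorem for `ℚ(2^{1/3})`, at every prime** (as used by Heath-Brown, p. 21: the
first-degree prime ideals above `p` are the `(p, n − 2^{1/3})` with `n³ ≡ 2 (mod p)`): the number
of ideals of `𝓞_K` of norm `p` equals the number of `n mod p` with `p ∣ n³ − 2`.
[cite: HeathBrownActa2001, §4 p. 21] -/
theorem card_absNorm_eq_prime {p : ℕ} (hp : p.Prime) :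
    Nat.card {I : Ideal (𝓞 K) // Ideal.absNorm I = p} =
      #((range p).filter fun n : ℕ => (p : ℤ) ∣ cubicPoly.eval (n : ℤ)) := by
  haveI := Fact.mk hp
  have hpe : ¬ p ∣ RingOfIntegers.exponent θint := by
    rw [exponent_θint, Nat.dvd_one]; exact hp.one_lt.ne'
  rw [Literature.NumberTheory.LFunctions.DegreeOnePrimes.card_absNorm_eq_prime_eq_card_roots hpe, minpoly_θint,
    Literature.NumberTheory.LFunctions.DegreeOnePrimes.card_roots_toFinset_eq_card_range_filter cubicPoly
      (map_monic_ne_zero cubicPoly_monic)]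

/-! ### Heath-Brown's Lemma 3.1 -/

/-- If `θ ≡ m (mod I)` for a rational integer `m`, every element of `𝓞_K = ℤ[θ]` is congruent to
a rational integer modulo `I` (p. 21: "any element of `ℤ[2^{1/3}]` is congruent to a rational
integer"). [cite: HeathBrownActa2001, §4 p. 21] -/
theorem quotient_mk_comp_surjective {I : Ideal (𝓞 K)} {m : ℤ} (hm : θint - m ∈ I) :
    Function.Surjective ((Ideal.Quotient.mk I).comp (algebraMap ℤ (𝓞 K))) := by
  intro b
  set φ := (Ideal.Quotient.mk I).comp (algebraMap ℤ (𝓞 K)) with hφ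
  have hsub : ∀ c ∈ Algebra.adjoin ℤ ({θint} : Set (𝓞 K)), Ideal.Quotient.mk I c ∈ φ.range := by
    intro c hc
    induction hc using Algebra.adjoin_induction with
    | mem x hx =>
        rw [Set.mem_singleton_iff] at hx
        subst hx
        refine ⟨m, ?_⟩
        rw [hφ, RingHom.comp_apply, Ideal.Quotient.eq, algebraMap_int_eq, eq_intCast]
        rw [← neg_sub]
        exact I.neg_mem hm
    | algebraMap r => exact ⟨r, rfl⟩
    | add x y _ _ hx hy => rw [map_add]; exact φ.range.add_mem hx hy
    | mul x y _ _ hx hy => rw [map_mul]; exact φ.range.mul_mem hx hy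
  obtain ⟨c, rfl⟩ := Ideal.Quotient.mk_surjective b
  obtain ⟨n, hn⟩ := hsub c (by rw [adjoin_θint_eq_top]; trivial)
  exact ⟨n, hn⟩

/-- If `p ∈ I`, `θ ≡ m (mod I)` and `I ≠ 𝓞_K`, then `𝓞_K/I ≅ ℤ/p` ("the residue field modulo `P`
has `p` elements", p. 21): `I` is a maximal ideal of norm `p`.
[cite: HeathBrownActa2001, §4 p. 21] -/
theorem absNorm_eq_and_isMaximal {I : Ideal (𝓞 K)} {p : ℕ} (hp : p.Prime) {m : ℤ}
    (hpI : (p : 𝓞 K) ∈ I) (hm : θint - m ∈ I) (hI : I ≠ ⊤) :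
    Ideal.absNorm I = p ∧ I.IsMaximal := by
  set φ := (Ideal.Quotient.mk I).comp (algebraMap ℤ (𝓞 K)) with hφ
  have hsurj := quotient_mk_comp_surjective hm
  haveI : Nontrivial (𝓞 K ⧸ I) := Ideal.Quotient.nontrivial_iff.2 hI
  have hker : RingHom.ker φ = Ideal.span {(p : ℤ)} := by
    haveI : (Ideal.span {(p : ℤ)}).IsMaximal :=
      Ideal.IsPrime.isMaximal ((Ideal.span_singleton_prime (by exact_mod_cast hp.ne_zero)).2
        (Nat.prime_iff_prime_int.1 hp)) (by simpa using hp.ne_zero)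
    refine (Ideal.IsMaximal.eq_of_le inferInstance (RingHom.ker_ne_top φ) ?_).symm
    rw [Ideal.span_le, Set.singleton_subset_iff, SetLike.mem_coe, RingHom.mem_ker, hφ,
      RingHom.comp_apply, map_natCast, Ideal.Quotient.eq_zero_iff_mem]
    exact hpI
  let e : (𝓞 K ⧸ I) ≃+* ZMod p :=
    ((RingHom.quotientKerEquivOfSurjective hsurj).symm.trans
      (Ideal.quotEquivOfEq hker)).trans (Int.quotientSpanNatEquivZMod p)
  haveI : NeZero p := ⟨hp.ne_zero⟩
  refine ⟨?_, ?_⟩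
  · rw [Ideal.absNorm_apply, Submodule.cardQuot_apply, Nat.card_congr e.toEquiv, Nat.card_zmod]
  · haveI := Fact.mk hp
    exact Ideal.Quotient.maximal_of_isField _ (e.toMulEquiv.isField (ZMod.instField p).toIsField)

/-- A proper ideal containing a rational prime `p` and a rational integer `x` forces `p ∣ x`.
[folklore] -/
theorem dvd_of_natCast_mem_of_intCast_mem {I : Ideal (𝓞 K)} {p : ℕ} (hp : p.Prime) {x : ℤ}
    (hpI : (p : 𝓞 K) ∈ I) (hxI : (x : 𝓞 K) ∈ I) (hI : I ≠ ⊤) : (p : ℤ) ∣ x := by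
  by_contra h
  have hcop : IsCoprime (p : ℤ) x := (Nat.prime_iff_prime_int.1 hp).coprime_iff_not_dvd.2 h
  obtain ⟨a, b, hab⟩ := hcop
  apply hI
  rw [Ideal.eq_top_iff_one]
  have : (1 : 𝓞 K) = a * p + b * x := by exact_mod_cast congrArg (Int.cast : ℤ → 𝓞 K) hab.symm
  rw [this]
  exact I.add_mem (I.mul_mem_left _ hpI) (I.mul_mem_left _ hxI)

/-- Below every nonzero prime ideal lies a rational prime. [folklore] -/
theorem exists_prime_natCast_mem {P : Ideal (𝓞 K)} (hP : P.IsPrime) (hP0 : P ≠ ⊥) :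
    ∃ q : ℕ, q.Prime ∧ (q : 𝓞 K) ∈ P := by
  classical
  have hn0 : Ideal.absNorm P ≠ 0 := fun h => hP0 (Ideal.absNorm_eq_zero_iff.mp h)
  have hmem : ((Ideal.absNorm P : ℕ) : 𝓞 K) ∈ P := Ideal.absNorm_mem P
  rw [Nat.prod_primeFactors_pow_factorization hn0, Nat.cast_prod] at hmem
  haveI := hP
  obtain ⟨q, hq, hqP⟩ := Ideal.IsPrime.prod_mem_iff.1 hmem
  rw [Nat.cast_pow] at hqP
  exact ⟨q, Nat.prime_of_mem_primeFactors hq, hP.mem_of_pow_mem _ hqP⟩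

/-- From a Bézout relation `a q + b y = 1`: `θ ≡ −b x (mod I)` whenever `q, x + yθ ∈ I`
(p. 21: "`2^{1/3} ≡ −x y^{−1} (mod P)`"). [cite: HeathBrownActa2001, §4 p. 21] -/
theorem θint_sub_mem_of_bezout {I : Ideal (𝓞 K)} {x y a b : ℤ} {q : ℕ}
    (hab : a * q + b * y = 1) (hqI : (q : 𝓞 K) ∈ I) (hmem : (x : 𝓞 K) + y * θint ∈ I) :
    θint - ((-(b * x) : ℤ) : 𝓞 K) ∈ I := by
  have h1 : (a : 𝓞 K) * (q : 𝓞 K) + b * y = 1 := by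
    exact_mod_cast congrArg (Int.cast : ℤ → 𝓞 K) hab
  have e : θint - ((-(b * x) : ℤ) : 𝓞 K) =
      (b : 𝓞 K) * ((x : 𝓞 K) + y * θint) + (a : 𝓞 K) * θint * (q : 𝓞 K) := by
    push_cast
    linear_combination (-θint) * h1
  rw [e]
  exact I.add_mem (I.mul_mem_left _ hmem) (I.mul_mem_left _ hqI)

/-- If `gcd(x, y) = 1` and a proper ideal `I` contains `x + yθ` and the rational prime `q`, then
`q ∤ y` (p. 21: "If `P ∣ y` then `P ∣ x`, so that `(x, y) ≠ 1`").
[cite: HeathBrownActa2001, §4 p. 21] -/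
theorem not_dvd_of_mem {I : Ideal (𝓞 K)} (hI : I ≠ ⊤) {x y : ℤ} (hxy : IsCoprime x y) {q : ℕ}
    (hq : q.Prime) (hqI : (q : 𝓞 K) ∈ I) (hmem : (x : 𝓞 K) + y * θint ∈ I) : ¬ (q : ℤ) ∣ y := by
  rintro ⟨k, hk⟩
  have hy : (y : 𝓞 K) * θint ∈ I := by
    rw [hk]; push_cast; rw [mul_assoc]
    exact I.mul_mem_right _ hqI
  have hx : (x : 𝓞 K) ∈ I := by simpa using I.sub_mem hmem hy
  have hqx := dvd_of_natCast_mem_of_intCast_mem hq hqI hx hI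
  exact (Nat.prime_iff_prime_int.1 hq).not_unit (hxy.isUnit_of_dvd' hqx ⟨k, hk⟩)

/-- The engine of Lemma 3.1: a proper ideal containing `x + yθ` (`gcd(x, y) = 1`) and a rational
prime `q` is a maximal ideal of norm `q` (namely `(q, θ − m)` for a suitable `m ∈ ℤ`).
[cite: HeathBrownActa2001, Lemma 3.1 (proof, p. 21)] -/
theorem absNorm_eq_of_prime_mem {I : Ideal (𝓞 K)} (hI : I ≠ ⊤) {x y : ℤ} (hxy : IsCoprime x y)
    {q : ℕ} (hq : q.Prime) (hqI : (q : 𝓞 K) ∈ I) (hmem : (x : 𝓞 K) + y * θint ∈ I) :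
    Ideal.absNorm I = q ∧ I.IsMaximal := by
  obtain ⟨a, b, hab⟩ :=
    (Nat.prime_iff_prime_int.1 hq).coprime_iff_not_dvd.2 (not_dvd_of_mem hI hxy hq hqI hmem)
  exact absNorm_eq_and_isMaximal hq hqI (θint_sub_mem_of_bezout hab hqI hmem) hI

/-- **Heath-Brown, Lemma 3.1, first assertion**: "No prime ideal of degree greater than `1` can
divide an element of `𝒜^(K)`" — every nonzero prime ideal containing `x + y·2^{1/3}` with
`gcd(x, y) = 1` has prime norm. [cite: HeathBrownActa2001, Lemma 3.1] -/
theorem prime_absNorm_of_mem {x y : ℤ} (hxy : IsCoprime x y) {P : Ideal (𝓞 K)} (hP : P.IsPrime)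
    (hP0 : P ≠ ⊥) (hmem : (x : 𝓞 K) + y * θint ∈ P) : (Ideal.absNorm P).Prime := by
  obtain ⟨q, hq, hqP⟩ := exists_prime_natCast_mem hP hP0
  rw [(absNorm_eq_of_prime_mem hP.ne_top hxy hq hqP hmem).1]
  exact hq

/-- **Heath-Brown, Lemma 3.1, second assertion**: "nor can a product of two distinct first degree
prime ideals of the same norm" divide `x + y·2^{1/3}` (`gcd(x, y) = 1`) — two prime ideals
containing it with equal norms coincide. [cite: HeathBrownActa2001, Lemma 3.1] -/
theorem eq_of_mem_of_absNorm_eq {x y : ℤ} (hxy : IsCoprime x y) {P₁ P₂ : Ideal (𝓞 K)}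
    (hP₁ : P₁.IsPrime) (hP₁0 : P₁ ≠ ⊥) (hP₂ : P₂ ≠ ⊤)
    (h₁ : (x : 𝓞 K) + y * θint ∈ P₁) (h₂ : (x : 𝓞 K) + y * θint ∈ P₂)
    (hN : Ideal.absNorm P₁ = Ideal.absNorm P₂) : P₁ = P₂ := by
  obtain ⟨q, hq, hqP₁⟩ := exists_prime_natCast_mem hP₁ hP₁0
  have hN₁ := (absNorm_eq_of_prime_mem hP₁.ne_top hxy hq hqP₁ h₁).1
  have hqP₂ : (q : 𝓞 K) ∈ P₂ := by
    have h := Ideal.absNorm_mem P₂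
    rwa [← hN, hN₁] at h
  obtain ⟨a, b, hab⟩ :=
    (Nat.prime_iff_prime_int.1 hq).coprime_iff_not_dvd.2 (not_dvd_of_mem hP₁.ne_top hxy hq hqP₁ h₁)
  set m : ℤ := -(b * x) with hm
  set I : Ideal (𝓞 K) := Ideal.span {(q : 𝓞 K), θint - (m : 𝓞 K)} with hIdef
  have hIq : (q : 𝓞 K) ∈ I := Ideal.subset_span (Set.mem_insert _ _)
  have hIm : θint - (m : 𝓞 K) ∈ I := Ideal.subset_span (Set.mem_insert_of_mem _ rfl)
  have hle : ∀ P : Ideal (𝓞 K), (q : 𝓞 K) ∈ P → (x : 𝓞 K) + y * θint ∈ P → I ≤ P := by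
    intro P hqP hP
    rw [hIdef, Ideal.span_le]
    rintro z (rfl | hz)
    · exact hqP
    · rw [Set.mem_singleton_iff] at hz
      rw [hz]
      exact θint_sub_mem_of_bezout hab hqP hP
  have hI₁ : I ≤ P₁ := hle P₁ hqP₁ h₁
  have hI₂ : I ≤ P₂ := hle P₂ hqP₂ h₂
  have hItop : I ≠ ⊤ := fun h => hP₁.ne_top (top_le_iff.1 (h ▸ hI₁))
  have hImax := (absNorm_eq_and_isMaximal hq hIq hIm hItop).2
  rw [← hImax.eq_of_le hP₁.ne_top hI₁, ← hImax.eq_of_le hP₂ hI₂]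

/-- **Heath-Brown, Lemma 3.1, conclusion**: "if a square-free ideal `R` divides an element of
`𝒜^(K)`, then `N(R)` must be square-free" — for `R ∋ x + y·2^{1/3}`, `gcd(x, y) = 1`.
[cite: HeathBrownActa2001, Lemma 3.1] -/
theorem squarefree_absNorm_of_mem {x y : ℤ} (hxy : IsCoprime x y) {R : Ideal (𝓞 K)}
    (hR : Squarefree R) (hmem : (x : 𝓞 K) + y * θint ∈ R) : Squarefree (Ideal.absNorm R) := by
  classical
  have hR0 : R ≠ ⊥ := by
    intro h
    rw [h, Ideal.zero_eq_bot.symm] at hR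
    exact not_squarefree_zero hR
  set F := UniqueFactorizationMonoid.normalizedFactors R with hF
  have hnodup : F.Nodup :=
    (UniqueFactorizationMonoid.squarefree_iff_nodup_normalizedFactors hR0).1 hR
  have hmemF : ∀ P ∈ F, P.IsPrime ∧ P ≠ ⊥ ∧ (x : 𝓞 K) + y * θint ∈ P := by
    intro P hP
    have h := (Ideal.mem_normalizedFactors_iff hR0).1 hP
    refine ⟨h.1, ?_, h.2 hmem⟩
    rintro rfl
    exact UniqueFactorizationMonoid.zero_notMem_normalizedFactors R
      (by rwa [Ideal.zero_eq_bot])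
  -- `N(R) = ∏_{P ∈ F} N(P)`, a product of pairwise distinct primes
  have hprod : Ideal.absNorm R = (F.map Ideal.absNorm).prod := by
    conv_lhs => rw [← Ideal.prod_normalizedFactors_eq_self hR0]
    rw [← hF, map_multiset_prod]
  have hprime : ∀ n ∈ F.map Ideal.absNorm, n.Prime := by
    intro n hn
    obtain ⟨P, hP, rfl⟩ := Multiset.mem_map.1 hn
    obtain ⟨hP1, hP2, hP3⟩ := hmemF P hP
    exact prime_absNorm_of_mem hxy hP1 hP2 hP3
  have hnodup' : (F.map Ideal.absNorm).Nodup := by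
    refine Multiset.Nodup.map_on (fun P hP P' hP' hN => ?_) hnodup
    obtain ⟨hP1, hP2, hP3⟩ := hmemF P hP
    obtain ⟨hP1', -, hP3'⟩ := hmemF P' hP'
    exact eq_of_mem_of_absNorm_eq hxy hP1 hP2 hP1'.ne_top hP3 hP3' hN
  set l := (F.map Ideal.absNorm).toList with hl
  have hlF : (l : Multiset ℕ) = F.map Ideal.absNorm := Multiset.coe_toList _
  have hlprod : l.prod = Ideal.absNorm R := by rw [hprod, hl, Multiset.prod_toList]
  have hlprime : ∀ n ∈ l, n.Prime := fun n hn => hprime n (by rwa [hl, Multiset.mem_toList] at hn)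
  have hn0 : Ideal.absNorm R ≠ 0 := by
    rw [← hlprod]
    exact List.prod_ne_zero fun h => (hlprime 0 h).ne_zero rfl
  rw [Nat.squarefree_iff_nodup_primeFactorsList hn0,
    ← (Nat.primeFactorsList_unique hlprod hlprime).nodup_iff, ← Multiset.coe_nodup, hlF]
  exact hnodup'

end Literature.NumberTheory.LFunctions.CubeRootTwoField

end
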